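import Summits.QuantumFields.BalabanUV.T4Continuum.Support.ShellMeasureLiveEndOneCallSlotLevelsCfLinJunction
import Summits.QuantumFields.BalabanUV.T4Continuum.Support.ShellMeasureRootCompositionSync

/-!
# `T4Continuum.ShellMeasureLiveEndOneCallLevelsCfLinJunction` — row S111 file 2⁶ «THE ONE CALL v5 — THE JUNCTION WAVE COLLECTED»: END-I ∘ END-II
# (the chain-end host `ShellMeasureLandauEndAssembledDecayCfLinCoTestsSchurCoarseReadOuts`) IN ONE DECLARATION — `ShellWeightBound` ⇐ THE
# NAMED BINDERS
(cell `pub-balaban`, sub-cell `t4`, NE7c (node U5b); crew unit `b2b-balaban-t4-ne7c-formalise-leaf-09` gen 14; owner table row **S111**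
(R-ne7cp1-g36-13); imports file 1⁶ `ShellMeasureLiveEndOneCallSlotLevelsCfLinJunction` and S27 `ShellMeasureRootCompositionSync`
ONLY; [folklore]; 0 `def`, 0 `def … : Prop`, 0 sorry, 0 citation tags; statement generated by the same script as
file 1⁶; the (x2⁶) `example` at the end is self-contained)

HONEST FRAMING.  Finite four-torus programme, rung (B)+1 only — NOT infinite volume, NOT a mass gap, NOT the Clay problem, NOT
summit progress; (B), `BetaPertHyp`, (B^μ) not consumed.  NE7c (`T4IndicatorShell.ShellWeightBound`) is NOT PRINTED in
[Balaban 1983–89] and NOT PROVED; «NE7c ⇐ the named binders» (trigger c3): every binder below is DISPLAYED, asserted by nobody;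
no estimate of Bałaban's is discharged; (M1) realized ≠ NE7c.  Equation numbers in comments LOCATE displayed shapes, not
citations.  HONEST DEPENDENCY (cell): continuum YM on T⁴ ⇐ BetaPertH ∧ nine spine estimates (0/9 proved); BetaPertH ⇐ (D1) ∧ (D4)
∧ CAP+tail; G-an2-4 gates asym, D1 and NE2/3/4.

THIS declaration (with file 3⁶'s union form) IS the countdown's object at the live levels; landing it moves NOTHING of Bałaban's — what moves is OUR
hypothesis count (the owner's census (x3⁶), two engines on the tree bytes: relative to v4 p238461∕p238484 every LEAVING set of the chain's links is
ABSENT and their ENTERING numbers ∕ structure present; expected [T] ≈ 84 − 6 − 1 − 4 − 5; my E1 preview is quoted in the PROPOSED line, the owner's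
two engines decide).

THE CHAIN as landed: (1) S108 f2 `ShellMeasureLandauEndAssembledDecayCfLinCoTestsSchur` (leaf-04-g11, p239037) → (2) S108 f3
`ShellMeasureLandauEndAssembledDecayCfLinCoTestsSchurElb` (leaf-07-g10, p239416) → (3) S110
`ShellMeasureLandauEndAssembledDecayCfLinCoTestsSchurCoarse` (leaf-03-g9, p239707) → (4) S109 f2
`ShellMeasureLandauEndAssembledDecayCfLinCoTestsSchurCoarseReadOuts` (leaf-08-g17, p240165) — its LEAVING ∕ ENTERING lists, link by link and in
words, are in file 1⁶'s module docstring (verbatim from the links' own headers; nothing of Bałaban's discharged at any link).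

WHAT IS PROVED ([folklore]). **`shellWeightBound_live_oneCall_levels_cfB7_lin_junction`** := END-I S27 `shellWeightBound_of_towerData_sync` (G :=
SU2; run `r`'s slot `s` of comparison `K` on `(P r K s, jl r K s)`; thresholds BY AGE `ε r (K − lvl r K s)`) with `hacA`∕`hacB` DISCHARGED by file
1⁶ `hac_live_of_assembled_decay_levels_cfB7_lin_junction` (host ∘ S90) at `r := true ∕ false`. Binders: file 1⁶'s `(r, K, t, s)`-families of EVERY
host binder VERBATIM; the slot→level majorant `hDslot` (the host's = S99 f3b's constant, written ONCE, level-lifted letters); END-I's rows VERBATIM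
((R)+[dict] per run with the NORMALISED variables `u ∕ η²` in the shell events, finiteness, `LiveWindow` ×2 (SM-L7), `0 < ϑ < 1`, `D ≤ D̄`, rates
(SM-L8, U1b BY NAME)). CONCLUSION LITERALLY `ShellWeightBound l₀ T A B shA shB (fun K => Σ_{s ∈ Sl true K} D true (lvl true K s)·ρ true (lvl true K
s) + Σ_{s ∈ Sl false K} …)` — token-identical to v4 f2⁵ p238461. Tests: (t1) ✓; (t2) NO `SlotAntiConcentration` hypothesis; (t3) WALL rows × both
runs + END-I (g)–(k), 0 `def … : Prop`; (t4) trio; (x1)∕G-1′: inherited — the two-scale witnesses of record are S96 f3 (v1′, p234491) and S106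
`ShellMeasureLiveEndOneCallUnionLevelsCfLinToy` (v3, leaf-10, p238739); every junction link carries or inherits its own (host, purpose) certificate
(R-ne7cp1-g36-3 (d)); (x2⁶) the in-file `example` below.
-/

noncomputable section

open Set Metric NormedSpace MeasureTheory Function Finset
open scoped ENNReal

namespace Summit.QuantumFields.BalabanUV.T4Continuum.ShellMeasureLiveEndOneCallLevelsCfLinJunction

open Literature.MathematicalPhysics.QuantumFieldTheory.Balaban1983to89
open B11Prop6Scheme (Prop4Hyp)
open GaugeField (GaugeInvariant)
open T4ShellMeasure (SlotAntiConcentration)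
open T4CubePoincare (cube)
open T4CubeChartGnomonic (SU2)
open T4CubeChartExp (expFibreChart)
open T4TreeGaugeFixing (NoClosedLoop fixTo)
open T4ShellMeasurePlaquette (expTail₂)
open ShellMeasureLevelAssembly (classifier)
open ShellMeasureMultiGridNorms (WSup)
open ShellMeasurePinnedNorm (pinW)
open ShellMeasureDecayKernelSums (kerOp)
open ShellMeasureLandauHolonomy (solAt landauExp)
open ShellMeasureLandauHolonomyChart (holOf cplx)
open ShellMeasureLandauHolonomySkew (readOutReal)
open ShellMeasureMultiGridNorms.WSup (toPiL)
open T4AxialGaugeSmallField (boxPlaqs boxBonds)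
open T4AxialGaugeFixing (combBonds)
open B7Prop2Explicit (C0 c2' unitaryUnits)
open B7Prop1Local (pdevOn loK bondHiK)
open B7Prop5Flat (BondIn)
open ShellMeasureAverageProp4General (O1cov C2cov)
open ShellMeasureLandauCorrectionB7 (landauCf landauRad)
open ShellMeasureLandauCorrectionReal (skewPi)
open ShellMeasureLandauCfBoxLocal (landauCfBox)
open T4IndicatorShell (ShellWeightBound)
open T4ShellMeasureLevels (LiveWindow)
open ShellMeasureRootCompositionSync (shellWeightBound_of_towerData_sync)
open ShellMeasureLiveEndOneCallSlotLevelsCfLinJunction (hac_live_of_assembled_decay_levels_cfB7_lin_junction)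

open TreeLengthTorus (TPt)
open B12Decay510Torus (pl1)
open ShellMeasurePinnedNorm (pinDist)
open ShellMeasureCommutatorCovDatum (covIdx covD)
open B7Prop1Explicit (U1)
open ShellMeasureReadOutsMax (Ysp plaqReadOuts)
open scoped Matrix.Norms.L2Operator

variable {σ : Type*} {n : Type*} [Fintype n] [DecidableEq n] [Nonempty n]

/-- **`ShellWeightBound` ⇐ THE NAMED BINDERS, AT THE LIVE LEVELS, IN ONE DECLARATION — AFTER THE JUNCTION WAVE** (row S111 file 2⁶;
see the module docstring).  CONDITIONAL on every displayed binder; nothing PRINTED is asserted; NOT Bałaban's minimiser; NOT NE7c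
proved — NE7c ⇐ these binders. [folklore] -/
theorem shellWeightBound_live_oneCall_levels_cfB7_lin_junction
    (P : Bool → ℕ → σ → Params) (jl lvl : Bool → ℕ → σ → ℕ) [∀ r K s, DecidableEq (PBond (P r K s) (jl r K s))]
    {ε η ρ β D : Bool → ℕ → ℝ} (hη : ∀ r j, 0 < η r j) (hε : ∀ r a, 0 < ε r a) (hρ0 : ∀ r j, 0 ≤ ρ r j) (hD0 : ∀ r j, 0 ≤ D r j)
    (Sl : Bool → ℕ → Finset σ) {l₀ : ℝ}
    -- EVERY END-II binder of the host lin_coTests_schur_elb_coarse_readOuts as an (r, K, t, s)-family — file 1's list VERBATIM (its section comments there)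
    {𝒵 ℬ : Bool → ℕ → σ → Type*} [∀ r K s, NormedAddCommGroup (𝒵 r K s)] [∀ r K s, NormedSpace ℂ (𝒵 r K s)] [∀ r K s, NormedAddCommGroup (ℬ r K s)]
    [∀ r K s, NormedSpace ℂ (ℬ r K s)] {𝔸 : Bool → ℕ → σ → Type*} [∀ r K s, CStarAlgebra (𝔸 r K s)] [∀ r K s, Nontrivial (𝔸 r K s)]
    {lo hi : ∀ r K s, Fin (P r K s).d → ℤ} {nb : Bool → ℕ → σ → ℕ} (hn : ∀ r K s, ∀ κ, hi r K s κ ≤ lo r K s κ + nb r K s)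
    (hN : ∀ r K s, ∀ κ, hi r K s κ - lo r K s κ < (P r K s).sitesPerDir (jl r K s)) (Λ : ∀ r K s, Finset (PBond (P r K s) (jl r K s)))
    (hΛbox : ∀ r K s, ∀ b ∈ Λ r K s, b ∈ boxBonds (lo r K s) (hi r K s)) (hΛcomb : ∀ r K s, Disjoint (Λ r K s) (combBonds (lo r K s) (hi r K s)))
    {m₀ : Bool → ℕ → σ → ℕ} (e : ∀ r K s, ↥(Λ r K s) × Fin 3 ≃ Fin (m₀ r K s)) {S : ℝ} (hS : 0 < S) (hSπ : 3 * S ^ 2 < Real.pi ^ 2)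
    {F : ∀ r K (t : ℝ) s, GaugeField (P r K s) (jl r K s) SU2 → ℝ≥0∞} (hF : ∀ r K t s, Measurable (F r K t s))
    (hFi : ∀ r K t s, GaugeInvariant (F r K t s)) {u : ∀ r K (t : ℝ) s, GaugeField (P r K s) (jl r K s) SU2 → ℝ}
    (hu : ∀ r K t s, Measurable (u r K t s)) (hui : ∀ r K t s, GaugeInvariant (u r K t s)) {ιc : Bool → ℕ → σ → Type*}
    {Pu : ∀ r K (t : ℝ) s, Finset (ιc r K s)} (hPu : ∀ r K t s, (Pu r K t s).Nonempty)
    (plq : ∀ r K (t : ℝ) s, ιc r K s → B7Prop1Explicit.Site (P r K s).d × Fin (P r K s).d × Fin (P r K s).d) {κN : Bool → ℕ → σ → Type*}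
    (N : ∀ r K (t : ℝ) s, Finset (κN r K s)) {ιN : ∀ r K s, κN r K s → Type*} {PuN : ∀ r K (t : ℝ) s, (i : κN r K s) → Finset (ιN r K s i)}
    (hPuN : ∀ r K t s, ∀ i, (PuN r K t s i).Nonempty) {AN : Bool → ℕ → σ → Type*} [∀ r K s, NormedRing (AN r K s)]
    [∀ r K s, NormedAlgebra ℂ (AN r K s)] [∀ r K s, CompleteSpace (AN r K s)]
    (holN : ∀ r K (t : ℝ) s, (i : κN r K s) → GaugeField (P r K s) (jl r K s) SU2 → ιN r K s i → (Fin (m₀ r K s) → ℝ) → AN r K s)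
    {θN RN HN δN : ∀ r K (t : ℝ) s, κN r K s → ℝ} (hRN : ∀ r K t s, ∀ i ∈ N r K t s, 1 < RN r K t s i)
    (hθN : ∀ r K t s, ∀ i ∈ N r K t s, 0 < θN r K t s i) (hδ0N : ∀ r K t s, ∀ i ∈ N r K t s, 0 ≤ δN r K t s i)
    (hδ1N : ∀ r K t s, ∀ i ∈ N r K t s, δN r K t s i ≤ 1)
    (hSMN : ∀ r K t s, ∀ i ∈ N r K t s, 36 * HN r K t s i * 1 ^ 2 / (RN r K t s i - 1) ^ 2 ≤ δN r K t s i * θN r K t s i)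
    (hANN : ∀ r K t s, ∀ i ∈ N r K t s, ∀ V, ∀ x ∈ closedBall (0 : Fin (m₀ r K s) → ℝ) S, ∀ p ∈ PuN r K t s i, ∃ f : ℂ → AN r K s, DifferentiableOn ℂ
      f (ball 0 (RN r K t s i)) ∧ (∀ w ∈ ball (0 : ℂ) (RN r K t s i), ‖f w‖ ≤ HN r K t s i) ∧ f 0 = 0 ∧ ∀ c : ℝ, 0 ≤ c → c ≤ 1 → f (c : ℂ) = holN r K
      t s i V p (c • x) - 1)
    {δ : ℝ}
    (Λu : ∀ r K (t : ℝ) s, Finset (B7Prop1Explicit.Site (P r K s).d × Fin (P r K s).d))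
    (U₀u : ∀ r K (t : ℝ) s, B7Prop1Explicit.Site (P r K s).d → Fin (P r K s).d → (Matrix n n ℂ)ˣ)
    (hU₀u : ∀ r K t s, ∀ y κ, U₀u r K t s y κ ∈ U1 (Matrix n n ℂ)) (wu : ∀ r K t s, ↥(Λu r K t s) → ℝ) (wu' : ∀ r K t s, ↥(covIdx (Λu r K t s)) → ℝ)
    [∀ r K t s, Fact (∀ b, 0 < wu r K t s b)] [∀ r K t s, Fact (∀ i, 0 < wu' r K t s i)] {w₀ w₀' : ℝ} (hw₀ : 0 < w₀) (hw₀' : 0 < w₀')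
    (hfl : ∀ r K t s, ∀ b, w₀ ≤ wu r K t s b) (hfl' : ∀ r K t s, ∀ i, w₀' ≤ wu' r K t s i)
    (𝒢 : ∀ r K t s, GaugeField (P r K s) (jl r K s) SU2 → (𝒵 r K s →L[ℂ] (Ysp (Λu r K t s) (η r (jl r K s)) (U₀u r K t s) (wu r K t s) (wu' r K t
      s))))
    (W𝒱 : ∀ r K t s, GaugeField (P r K s) (jl r K s) SU2 → (Ysp (Λu r K t s) (η r (jl r K s)) (U₀u r K t s) (wu r K t s) (wu' r K t s)) → 𝒵 r K s)
    {B₀ C₄ a₃ ε₄ : ℝ} (h𝒢 : ∀ r K t s, ∀ V f, ‖𝒢 r K t s V f‖ ≤ B₀ * ‖f‖) (hW : ∀ r K t s, ∀ V, Prop4Hyp (W𝒱 r K t s V) C₄ a₃) (hB₀ : 0 < B₀)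
    (hC₄ : 0 ≤ C₄) (hε₄ : 0 ≤ ε₄) {dL C₁ B₃ ε₁ : ℝ} (hdL : 0 ≤ dL) (hC₁ : 0 ≤ C₁) (hε₁ : 0 ≤ ε₁) (hB₃ : dL ≤ B₃) (h1 : 2 * B₀ * C₁ * B₃ * ε₁ ≤ ε₄)
    (h2 : 4 * ε₄ ≤ a₃) (h3 : 16 * B₀ * C₄ * ε₄ ≤ 1)
    (H₁ : ∀ r K t s, GaugeField (P r K s) (jl r K s) SU2 → (ℬ r K s →L[ℂ] (Ysp (Λu r K t s) (η r (jl r K s)) (U₀u r K t s) (wu r K t s) (wu' r K t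
      s))))
    (hH₁ : ∀ r K t s, ∀ V B, ‖H₁ r K t s V B‖ ≤ B₀ * ‖B‖)
    (TΦ : ∀ r K (t : ℝ) s, GaugeField (P r K s) (jl r K s) SU2 → ((Fin (m₀ r K s) → ℂ) →L[ℂ] (ℬ r K s))) {rΦ : ℝ}
    (hTb : ∀ r K t s, ∀ V, ‖TΦ r K t s V‖ * rΦ < 2 * dL * C₁ * ε₁) (hSr : S < rΦ) (k : Bool → ℕ → σ → ℕ)
    (Sf Sf' Sw Sw' Se Se' : ∀ r K s, Finset (B7Prop1Explicit.Site (P r K s).d × Fin (P r K s).d))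
    (Ubg : ∀ r K (t : ℝ) s, GaugeField (P r K s) (jl r K s) SU2 → B7Prop1Explicit.Site (P r K s).d → Fin (P r K s).d → (𝔸 r K s)ˣ)
    (hUbg : ∀ r K t s, ∀ V x κ, Ubg r K t s V x κ ∈ unitaryUnits (𝔸 r K s)) {α₀ : ℝ} (hα : 0 < α₀) (hα3 : ∀ r K s, C0 (P r K s).d * α₀ ≤ 1 / 3)
    (hα4 : ∀ r K s, 4 * α₀ ≤ c2' (P r K s).d (P r K s).L) (hα6 : ∀ r K s, 4 * O1cov (P r K s).d * α₀ ≤ 1 / 3)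
    (h52locw : ∀ r K t s, ∀ V (c : ↥(Sw' r K s)), pdevOn (loK (P r K s).L (k r K s) c.1.1) (bondHiK (P r K s).L (k r K s) c.1.1 c.1.2) (Ubg r K t s V)
      < α₀ * ((((P r K s).L : ℝ) ^ k r K s)⁻¹) ^ 2)
    (h52loce : ∀ r K t s, ∀ V (c : ↥(Se' r K s)), pdevOn (loK (P r K s).L (k r K s) c.1.1) (bondHiK (P r K s).L (k r K s) c.1.1 c.1.2) (Ubg r K t s V)
      < α₀ * ((((P r K s).L : ℝ) ^ k r K s)⁻¹) ^ 2)
    (ϖe₁ : ∀ r K (t : ℝ) s, ↥(Se r K s) → ℝ) (ϖe₂ : ∀ r K (t : ℝ) s, ↥(Se' r K s) → ℝ) (hϖe₁ : ∀ r K t s, ∀ b, 0 ≤ ϖe₁ r K t s b)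
    (hϖe₂ : ∀ r K t s, ∀ c, 0 ≤ ϖe₂ r K t s c) {r₀e : ℝ}
    (hreache : ∀ r K t s, ∀ (c : ↥(Se' r K s)) (b : ↥(Se r K s)), BondIn (loK (P r K s).L (k r K s) c.1.1) (bondHiK (P r K s).L (k r K s) c.1.1 c.1.2)
      b.1.1 b.1.2 → ϖe₂ r K t s c - r₀e ≤ ϖe₁ r K t s b)
    (ιs : ∀ r K t s, GaugeField (P r K s) (jl r K s) SU2 → ((Ysp (Λu r K t s) (η r (jl r K s)) (U₀u r K t s) (wu r K t s) (wu' r K t s)) →L[ℂ] (↥(Sf r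
      K s) → 𝔸 r K s)))
    (hι : ∀ r K t s, ∀ V Y, ‖ιs r K t s V Y‖ ≤ ‖Y‖)
    (Hop : ∀ r K t s, GaugeField (P r K s) (jl r K s) SU2 → ((↥(Sf' r K s) → 𝔸 r K s) →L[ℂ] (Ysp (Λu r K t s) (η r (jl r K s)) (U₀u r K t s) (wu r K t
      s) (wu' r K t s))))
    (hH : ∀ r K t s, ∀ V X, ‖Hop r K t s V X‖ ≤ B₀ * ‖X‖) {ε₃ : ℝ} (h18 : ∀ r K s, 18 * C2cov (P r K s).d * B₀ * ε₃ ≤ 1)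
    (hcoup : ε₄ + B₀ * (2 * dL * C₁ * ε₁) ≤ ε₃) (h3R : ∀ r K s, 3 * ε₃ ≤ landauRad (P r K s).d (P r K s).L) {Λw Λz Λb : Bool → ℕ → σ → Type*}
    [∀ r K s, Fintype (Λw r K s)] [∀ r K s, DecidableEq (Λw r K s)] [∀ r K s, Fintype (Λz r K s)] [∀ r K s, Fintype (Λb r K s)]
    {𝔄w ℭ 𝔇 : Bool → ℕ → σ → Type*} [∀ r K s, NormedAddCommGroup (𝔄w r K s)] [∀ r K s, NormedSpace ℂ (𝔄w r K s)] [∀ r K s, CompleteSpace (𝔄w r K s)]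
    [∀ r K s, NormedAddCommGroup (ℭ r K s)] [∀ r K s, NormedSpace ℂ (ℭ r K s)] [∀ r K s, NormedAddCommGroup (𝔇 r K s)]
    [∀ r K s, NormedSpace ℂ (𝔇 r K s)] {δw : ℝ} (hδw : 0 ≤ δw) {Nc : Bool → ℕ → σ → ℕ} [∀ r K s, NeZero (Nc r K s)]
    (Bref : ∀ r K (t : ℝ) s, Finset (TPt (P r K s).d (Nc r K s))) (hBref : ∀ r K t s, (Bref r K t s).Nonempty)
    (pos : ∀ r K (t : ℝ) s, Λw r K s → TPt (P r K s).d (Nc r K s)) (posz : ∀ r K (t : ℝ) s, Λz r K s → TPt (P r K s).d (Nc r K s))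
    (pos' : ∀ r K (t : ℝ) s, ↥(Sw r K s) → TPt (P r K s).d (Nc r K s)) (posx : ∀ r K (t : ℝ) s, ↥(Sw' r K s) → TPt (P r K s).d (Nc r K s))
    (posb : ∀ r K (t : ℝ) s, Λb r K s → TPt (P r K s).d (Nc r K s)) {multw multz multx multb : ℕ}
    (hmultw : ∀ r K t s, ∀ x, (Finset.univ.filter fun b' => pos r K t s b' = x).card ≤ multw)
    (hmultz : ∀ r K t s, ∀ x, (Finset.univ.filter fun b' => posz r K t s b' = x).card ≤ multz)
    (hmultx : ∀ r K t s, ∀ x, (Finset.univ.filter fun b' => posx r K t s b' = x).card ≤ multx)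
    (hmultb : ∀ r K t s, ∀ x, (Finset.univ.filter fun b' => posb r K t s b' = x).card ≤ multb)
    (k𝒢 : ∀ r K (t : ℝ) s, GaugeField (P r K s) (jl r K s) SU2 → Λw r K s → Λz r K s → (ℭ r K s →L[ℂ] (𝔄w r K s)))
    (kι : ∀ r K (t : ℝ) s, GaugeField (P r K s) (jl r K s) SU2 → ↥(Sw r K s) → Λw r K s → (𝔄w r K s →L[ℂ] (𝔸 r K s)))
    (kH : ∀ r K (t : ℝ) s, GaugeField (P r K s) (jl r K s) SU2 → Λw r K s → ↥(Sw' r K s) → (𝔸 r K s →L[ℂ] (𝔄w r K s)))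
    (kH₁ : ∀ r K (t : ℝ) s, GaugeField (P r K s) (jl r K s) SU2 → Λw r K s → Λb r K s → (𝔇 r K s →L[ℂ] (𝔄w r K s)))
    {c𝒢 δ𝒢 M𝒢 cι δι Mι cH δH MH cH₁ δH₁ MH₁ : ℝ} (hc𝒢 : 0 ≤ c𝒢)
    (hk𝒢 : ∀ r K t s, ∀ V c b', ‖k𝒢 r K t s V c b'‖ ≤ c𝒢 * Real.exp (-(δ𝒢 * pl1 (pos r K t s c - posz r K t s b')))) (hgap𝒢 : δw < δ𝒢)
    (hM𝒢c : ∀ r K s, (multz : ℝ) * (2 * (((P r K s).d : ℝ) + (δ𝒢 - δw)) / (δ𝒢 - δw)) ^ (P r K s).d ≤ M𝒢) (hcι : 0 ≤ cι)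
    (hkι : ∀ r K t s, ∀ V c b', ‖kι r K t s V c b'‖ ≤ cι * Real.exp (-(δι * pl1 (pos' r K t s c - pos r K t s b')))) (hgapι : δw < δι)
    (hMιc : ∀ r K s, (multw : ℝ) * (2 * (((P r K s).d : ℝ) + (δι - δw)) / (δι - δw)) ^ (P r K s).d ≤ Mι) (hcH : 0 ≤ cH)
    (hkH : ∀ r K t s, ∀ V c b', ‖kH r K t s V c b'‖ ≤ cH * Real.exp (-(δH * pl1 (pos r K t s c - posx r K t s b')))) (hgapH : δw < δH)
    (hMHc : ∀ r K s, (multx : ℝ) * (2 * (((P r K s).d : ℝ) + (δH - δw)) / (δH - δw)) ^ (P r K s).d ≤ MH) (hcH₁ : 0 ≤ cH₁)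
    (hkH₁ : ∀ r K t s, ∀ V c b', ‖kH₁ r K t s V c b'‖ ≤ cH₁ * Real.exp (-(δH₁ * pl1 (pos r K t s c - posb r K t s b')))) (hgapH₁ : δw < δH₁)
    (hMH₁c : ∀ r K s, (multb : ℝ) * (2 * (((P r K s).d : ℝ) + (δH₁ - δw)) / (δH₁ - δw)) ^ (P r K s).d ≤ MH₁)
    (W𝒱w : ∀ r K (t : ℝ) s, GaugeField (P r K s) (jl r K s) SU2 → (Λw r K s → 𝔄w r K s) → (Λz r K s → ℭ r K s)) {B₀w C₄w a₃w ε₄w bw : ℝ}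
    (hB𝒢w : c𝒢 * M𝒢 ≤ B₀w) (hWw : ∀ r K t s, ∀ V, Prop4Hyp (W𝒱w r K t s V) C₄w a₃w) (hB₀w : 0 < B₀w) (hC₄w : 0 ≤ C₄w) (hε₄w : 0 ≤ ε₄w)
    (hdomw : 2 * (ε₄w + B₀w * bw) ≤ a₃w) (hselfw : B₀w * C₄w * (ε₄w + B₀w * bw) ^ 2 ≤ ε₄w) (hcontrw : 4 * B₀w * C₄w * (ε₄w + B₀w * bw) < 1)
    (hBH₁w : cH₁ * MH₁ ≤ B₀w) (Tw : ∀ r K (t : ℝ) s, GaugeField (P r K s) (jl r K s) SU2 → ((Fin (m₀ r K s) → ℂ) →L[ℂ] (Λb r K s → 𝔇 r K s)))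
    {rΦw : ℝ} (hTbw : ∀ r K t s, ∀ V, ‖Tw r K t s V‖ * rΦw < bw) (h2Sw : 2 * S ≤ rΦw) (hιw : ∀ r K t s, ∀ V Y, ‖kerOp (kι r K t s V) Y‖ ≤ ‖Y‖)
    (hBHw : cH * MH ≤ B₀w) (hqw : ∀ r K s, 9 * C2cov (P r K s).d * B₀w * (ε₄w + B₀w * bw) < 1)
    (hRCw : ∀ r K s, 6 * (ε₄w + B₀w * bw) ≤ landauRad (P r K s).d (P r K s).L) (NW : ∀ r K (t : ℝ) s, Λz r K s → Λw r K s → Prop)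
    (hlocW : ∀ r K t s, ∀ V, ∀ A A' : Λw r K s → 𝔄w r K s, ∀ c', (∀ b', NW r K t s c' b' → A b' = A' b') → W𝒱w r K t s V A c' = W𝒱w r K t s V A' c')
    {rW : ℝ}
    (hreachW : ∀ r K t s, ∀ c' b', NW r K t s c' b' → pinDist (Bref r K t s) (hBref r K t s) (posz r K t s c') - rW ≤ pinDist (Bref r K t s) (hBref r
      K t s) (pos r K t s b'))
    {rC : ℝ}
    (hreachC : ∀ r K t s, ∀ (c' : ↥(Sw' r K s)) (b' : ↥(Sw r K s)), BondIn (loK (P r K s).L (k r K s) c'.1.1) (bondHiK (P r K s).L (k r K s) c'.1.1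
      c'.1.2) b'.1.1 b'.1.2 → pinDist (Bref r K t s) (hBref r K t s) (posx r K t s c') - rC ≤ pinDist (Bref r K t s) (hBref r K t s) (pos' r K t s
      b'))
    (hsupp : ∀ r K t s, ∀ V, ∀ z : Fin (m₀ r K s) → ℂ, ∀ i, 0 < pinDist (Bref r K t s) (hBref r K t s) (posb r K t s i) → Tw r K t s V z i = 0)
    (hqW : c𝒢 * M𝒢 * (2 * C₄w * a₃w * Real.exp (δw * rW)) < 1)
    (hk : ∀ r K s, 2 * C2cov (P r K s).d * landauRad (P r K s).d (P r K s).L * Real.exp (δw * rC) * (cι * Mι) * (cH * MH) < 1)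
    {𝔭 : Bool → ℕ → σ → Type*} (Pw : ∀ r K (t : ℝ) s, Finset (𝔭 r K s))
    (ℓw : ∀ r K (t : ℝ) s, 𝔭 r K s → List ((Λw r K s → 𝔄w r K s) →L[ℂ] Matrix n n ℂ)) (suppw : ∀ r K (t : ℝ) s, 𝔭 r K s → Finset (Λw r K s))
    (ϖPw : ∀ r K (t : ℝ) s, 𝔭 r K s → ℝ)
    (hblindw : ∀ r K t s, ∀ p ∈ Pw r K t s, ∀ ℓ ∈ ℓw r K t s p, ∀ A A' : Λw r K s → 𝔄w r K s, (∀ b' ∈ suppw r K t s p, A b' = A' b') → ℓ A = ℓ A')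
    (hdepthw : ∀ r K t s, ∀ p ∈ Pw r K t s, ∀ b' ∈ suppw r K t s p, ϖPw r K t s p ≤ pinDist (Bref r K t s) (hBref r K t s) (pos r K t s b'))
    (hϖPw : ∀ r K t s, ∀ p ∈ Pw r K t s, 0 ≤ ϖPw r K t s p) {κwb κcb : Bool → ℕ → ℝ} (hκwb : ∀ r K s, 0 ≤ κwb r (jl r K s))
    (hκcb : ∀ r K s, 0 ≤ κcb r (jl r K s)) (hℓwb : ∀ r K t s, ∀ p ∈ Pw r K t s, ∀ ℓ ∈ ℓw r K t s p, ‖ℓ‖ ≤ κwb r (jl r K s))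
    (hcurlw : ∀ r K t s, ∀ p ∈ Pw r K t s, ‖(ℓw r K t s p).sum‖ ≤ κcb r (jl r K s)) {mw : ℕ}
    (hlenw : ∀ r K t s, ∀ p ∈ Pw r K t s, (ℓw r K t s p).length ≤ mw) (𝓡𝒴w : ∀ r K (t : ℝ) s, AddSubgroup (Λw r K s → 𝔄w r K s))
    (h𝓡𝒴w : ∀ r K t s, IsClosed (𝓡𝒴w r K t s : Set (Λw r K s → 𝔄w r K s))) (𝓡𝒵w : ∀ r K (t : ℝ) s, AddSubgroup (Λz r K s → ℭ r K s))
    (𝓡ℬw : ∀ r K (t : ℝ) s, AddSubgroup (Λb r K s → 𝔇 r K s)) (h𝒢rw : ∀ r K t s, ∀ V, ∀ f ∈ 𝓡𝒵w r K t s, kerOp (k𝒢 r K t s V) f ∈ 𝓡𝒴w r K t s)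
    (hWrw : ∀ r K t s, ∀ V, ∀ Y ∈ 𝓡𝒴w r K t s, W𝒱w r K t s V Y ∈ 𝓡𝒵w r K t s)
    (hιrw : ∀ r K t s, ∀ V, ∀ Y ∈ 𝓡𝒴w r K t s, kerOp (kι r K t s V) Y ∈ skewPi ↥(Sw r K s))
    (hHrw : ∀ r K t s, ∀ V, ∀ X ∈ skewPi (𝔸 := 𝔸 r K s) ↥(Sw' r K s), kerOp (kH r K t s V) X ∈ 𝓡𝒴w r K t s)
    (hH₁rw : ∀ r K t s, ∀ V, ∀ B ∈ 𝓡ℬw r K t s, kerOp (kH₁ r K t s V) B ∈ 𝓡𝒴w r K t s)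
    (hTrw : ∀ r K t s, ∀ V (y : Fin (m₀ r K s) → ℝ), Tw r K t s V (cplx y) ∈ 𝓡ℬw r K t s)
    (hskew : ∀ r K t s, ∀ p ∈ Pw r K t s, ∀ ℓ ∈ ℓw r K t s p, ∀ Y ∈ 𝓡𝒴w r K t s, ℓ Y ∈ skewAdjoint (Matrix n n ℂ))
    (Bp : ∀ r K (t : ℝ) s, GaugeField (P r K s) (jl r K s) SU2 → 𝔭 r K s → Matrix n n ℂ) {d : ∀ r K (t : ℝ) s, 𝔭 r K s → ℝ} {dbar : Bool → ℕ → ℝ}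
    (hBu : ∀ r K t s, ∀ V, ∀ p ∈ Pw r K t s, Bp r K t s V p ∈ unitary (Matrix n n ℂ))
    (hBd : ∀ r K t s, ∀ V, ∀ p ∈ Pw r K t s, ‖Bp r K t s V p - 1‖ ≤ d r K t s p) (hd : ∀ r K t s, ∀ p ∈ Pw r K t s, d r K t s p ≤ dbar r (jl r K s))
    (hdbar : ∀ r K s, 0 ≤ dbar r (jl r K s)) {Kw : Bool → ℕ → ℝ}
    (hKw : ∀ r K t s, ∑ p ∈ Pw r K t s, Real.exp (-(δw * ϖPw r K t s p)) ≤ Kw r (jl r K s)) {Λe : Bool → ℕ → σ → Type*} [∀ r K s, Fintype (Λe r K s)]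
    {𝔄 : Bool → ℕ → σ → Type*} [∀ r K s, NormedAddCommGroup (𝔄 r K s)] [∀ r K s, NormedSpace ℂ (𝔄 r K s)] [∀ r K s, CompleteSpace (𝔄 r K s)] {δ' : ℝ}
    {ϖ : ∀ r K (t : ℝ) s, Λe r K s → ℝ} (hδ' : 0 ≤ δ') (hϖ : ∀ r K t s, ∀ b', 0 ≤ ϖ r K t s b') {𝒵e ℬe : Bool → ℕ → σ → Type*}
    [∀ r K s, NormedAddCommGroup (𝒵e r K s)] [∀ r K s, NormedSpace ℂ (𝒵e r K s)] [∀ r K s, NormedAddCommGroup (ℬe r K s)]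
    [∀ r K s, NormedSpace ℂ (ℬe r K s)]
    (𝒢e : ∀ r K t s, GaugeField (P r K s) (jl r K s) SU2 → (𝒵e r K s →L[ℂ] WSup (pinW δ' (ϖ r K t s)) 1 (𝔄 r K s)))
    (W𝒱e : ∀ r K t s, GaugeField (P r K s) (jl r K s) SU2 → WSup (pinW δ' (ϖ r K t s)) 1 (𝔄 r K s) → 𝒵e r K s) {B₀e C₄e a₃e be ε₄e : ℝ}
    (h𝒢e : ∀ r K t s, ∀ V f, ‖𝒢e r K t s V f‖ ≤ B₀e * ‖f‖) (hWe : ∀ r K t s, ∀ V, Prop4Hyp (W𝒱e r K t s V) C₄e a₃e) (hB₀e : 0 < B₀e) (hC₄e : 0 ≤ C₄e)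
    (hbe : 0 ≤ be) (hε₄e : 0 ≤ ε₄e) (hdome : 2 * (ε₄e + B₀e * be) ≤ a₃e) (hselfe : B₀e * C₄e * (ε₄e + B₀e * be) ^ 2 ≤ ε₄e)
    (hcontre : 4 * B₀e * C₄e * (ε₄e + B₀e * be) < 1)
    (H₁e : ∀ r K t s, GaugeField (P r K s) (jl r K s) SU2 → (ℬe r K s →L[ℂ] WSup (pinW δ' (ϖ r K t s)) 1 (𝔄 r K s)))
    (hH₁e : ∀ r K t s, ∀ V B, ‖H₁e r K t s V B‖ ≤ B₀e * ‖B‖)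
    (Te : ∀ r K (t : ℝ) s, GaugeField (P r K s) (jl r K s) SU2 → ((Fin (m₀ r K s) → ℂ) →L[ℂ] (ℬe r K s))) {rΦe : ℝ}
    (hTbe : ∀ r K t s, ∀ V, ‖Te r K t s V‖ * rΦe < be) (hSre : S < rΦe)
    (ιe : ∀ r K t s, GaugeField (P r K s) (jl r K s) SU2 → (WSup (pinW δ' (ϖ r K t s)) 1 (𝔄 r K s) →L[ℂ] WSup (pinW δ' (ϖe₁ r K t s)) 1 (𝔸 r K s)))
    (hιe : ∀ r K t s, ∀ V Y, ‖ιe r K t s V Y‖ ≤ ‖Y‖)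
    (He : ∀ r K t s, GaugeField (P r K s) (jl r K s) SU2 → (WSup (pinW δ' (ϖe₂ r K t s)) 1 (𝔸 r K s) →L[ℂ] WSup (pinW δ' (ϖ r K t s)) 1 (𝔄 r K s)))
    (hHe : ∀ r K t s, ∀ V X, ‖He r K t s V X‖ ≤ B₀e * ‖X‖)
    (hqe : ∀ r K s, 9 * (C2cov (P r K s).d * Real.exp (2 * δ' * r₀e)) * B₀e * (ε₄e + B₀e * be) < 1)
    (hRCe : ∀ r K s, 3 * (ε₄e + B₀e * be) ≤ landauRad (P r K s).d (P r K s).L) {𝔱 : Bool → ℕ → σ → Type*} (I : ∀ r K (t : ℝ) s, Finset (𝔱 r K s))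
    {Ef : ∀ r K (t : ℝ) s, 𝔱 r K s → (Λe r K s → 𝔄 r K s) → ℂ} {rE : ℝ} {ee : ∀ r K (t : ℝ) s, 𝔱 r K s → ℝ} (hrE : 0 < rE)
    (hEd : ∀ r K t s, ∀ i ∈ I r K t s, DifferentiableOn ℂ (Ef r K t s i) (ball 0 rE))
    (hEb : ∀ r K t s, ∀ i ∈ I r K t s, ∀ Z ∈ ball (0 : Λe r K s → 𝔄 r K s) rE, ‖Ef r K t s i Z‖ ≤ ee r K t s i)
    (supp : ∀ r K (t : ℝ) s, 𝔱 r K s → Finset (Λe r K s))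
    (hblind : ∀ r K t s, ∀ i ∈ I r K t s, ∀ A₁ A₂ : Λe r K s → 𝔄 r K s, (∀ b' ∈ supp r K t s i, A₁ b' = A₂ b') → Ef r K t s i A₁ = Ef r K t s i A₂)
    (ϖP : ∀ r K (t : ℝ) s, 𝔱 r K s → ℝ) (hdepth : ∀ r K t s, ∀ i ∈ I r K t s, ∀ b' ∈ supp r K t s i, ϖP r K t s i ≤ ϖ r K t s b') {LK : ℝ}
    (hK : ∀ r K t s, ∑ i ∈ I r K t s, 2 * ee r K t s i / rE * Real.exp (-(δ' * ϖP r K t s i)) ≤ LK)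
    (hcoupE : ∀ r K s, ((ε₄e + B₀e * be) + B₀e * (4 * (C2cov (P r K s).d * Real.exp (2 * δ' * r₀e)) * (ε₄e + B₀e * be) ^ 2)) ≤ rE / 2)
    {Ω : Bool → ℕ → σ → Type*} [∀ r K s, MeasurableSpace (Ω r K s)] (μ : ∀ r K (t : ℝ) s, Measure (Ω r K s)) {g : ∀ r K (t : ℝ) s, Ω r K s → ℝ}
    (hg : ∀ r K t s, ∀ ω, 0 ≤ g r K t s ω) (Aex : ∀ r K (t : ℝ) s, GaugeField (P r K s) (jl r K s) SU2 → (Fin (m₀ r K s) → ℝ) → Ω r K s → ℝ) {Bd : ℝ}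
    (hint : ∀ r K t s, ∀ V, ∀ x ∈ closedBall (0 : Fin (m₀ r K s) → ℝ) S, ∀ c : ℝ, 1 / 2 ≤ c → c ≤ 1 → Integrable (fun ω => g r K t s ω * Real.exp (Aex
      r K t s V (c • x) ω)) (μ r K t s))
    (hpos : ∀ r K t s, ∀ V, ∀ x ∈ closedBall (0 : Fin (m₀ r K s) → ℝ) S, ∀ c : ℝ, 1 / 2 ≤ c → c ≤ 1 → 0 < ∫ ω, g r K t s ω * Real.exp (Aex r K t s V
      (c • x) ω) ∂(μ r K t s))
    (hA : ∀ r K t s, ∀ V, ∀ x ∈ closedBall (0 : Fin (m₀ r K s) → ℝ) S, ∀ c : ℝ, 1 / 2 ≤ c → c ≤ 1 → ∀ ω, Aex r K t s V x ω ≤ Aex r K t s V (c • x) ω +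
      (1 - c) * Bd)
    {BE₂ : ℝ}
    (hElb₂ : ∀ r K t s, ∀ V (y : Fin (m₀ r K s) → ℝ), ‖y‖ ≤ S → -BE₂ ≤ (-Real.log (∫ ω, g r K t s ω * Real.exp (Aex r K t s V y ω) ∂(μ r K t s))))
    (L : ∀ r K t s, Set ((Ysp (Λu r K t s) (η r (jl r K s)) (U₀u r K t s) (wu r K t s) (wu' r K t s)) →L[ℂ] Matrix n n ℂ))
    (𝓡𝒵 : ∀ r K (t : ℝ) s, AddSubgroup (𝒵 r K s)) (𝓡ℬ : ∀ r K (t : ℝ) s, AddSubgroup (ℬ r K s))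
    (h𝒢r : ∀ r K t s, ∀ V, ∀ f ∈ 𝓡𝒵 r K t s, 𝒢 r K t s V f ∈ readOutReal (L r K t s))
    (hWr : ∀ r K t s, ∀ V, ∀ Y ∈ readOutReal (L r K t s), W𝒱 r K t s V Y ∈ 𝓡𝒵 r K t s)
    (hιr : ∀ r K t s, ∀ V, ∀ Y ∈ readOutReal (L r K t s), ιs r K t s V Y ∈ skewPi ↥(Sf r K s))
    (hHr : ∀ r K t s, ∀ V, ∀ X ∈ skewPi (𝔸 := 𝔸 r K s) ↥(Sf' r K s), Hop r K t s V X ∈ readOutReal (L r K t s))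
    (hH₁r : ∀ r K t s, ∀ V, ∀ B ∈ 𝓡ℬ r K t s, H₁ r K t s V B ∈ readOutReal (L r K t s))
    (hTr : ∀ r K t s, ∀ V (y : Fin (m₀ r K s) → ℝ), TΦ r K t s V (cplx y) ∈ 𝓡ℬ r K t s)
    (hRdict : ∀ r K t s, ∀ V, ∀ x ∈ cube (m₀ r K s) S, F r K t s (fixTo (combBonds (lo r K s) (hi r K s)) 1 (updateFinset V (Λ r K s) (expFibreChart
      (Λ r K s) 1 (e r K s) x))) = (closedBall (0 : Fin (m₀ r K s) → ℝ) S ∩ ⋂ i ∈ N r K t s, {y | classifier (hPuN r K t s i) (holN r K t s i V) y <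
      θN r K t s i}).indicator (1 : (Fin (m₀ r K s) → ℝ) → ℝ≥0∞) x * ENNReal.ofReal (Real.exp (-((∑ p ∈ Pw r K t s, β r (jl r K s) * (1 -
      (Matrix.trace (Bp r K t s V p * holOf (ℓw r K t s p) (fun y => landauExp (landauCfBox (P r K s).L (Ubg r K t s V) (k r K s) (Sw r K s) (Sw' r K
      s) (landauRad (P r K s).d (P r K s).L)) (kerOp (kι r K t s V)) (kerOp (kH r K t s V)) (4 * C2cov (P r K s).d * (ε₄w + B₀w * bw) ^ 2) (solAt
      (kerOp (k𝒢 r K t s V)) 0 (W𝒱w r K t s V) ε₄w (0 : Λz r K s → ℭ r K s) (kerOp (kH₁ r K t s V) (Tw r K t s V (cplx y))) + kerOp (kH₁ r K t s V)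
      (Tw r K t s V (cplx y)))) x)).re / Fintype.card n)) + ((∑ i ∈ I r K t s, Ef r K t s i (WSup.toPiL (𝔄 := 𝔄 r K s) (pinW δ' (ϖ r K t s)) 1
      (landauExp (fun Y : WSup (pinW δ' (ϖe₁ r K t s)) 1 (𝔸 r K s) => ((toPiL (pinW δ' (ϖe₂ r K t s)) 1).symm (landauCf (P r K s).L (Ubg r K t s V) (k
      r K s) (Se r K s) (Se' r K s) (toPiL (pinW δ' (ϖe₁ r K t s)) 1 Y)) : WSup (pinW δ' (ϖe₂ r K t s)) 1 (𝔸 r K s))) (ιe r K t s V) (He r K t s V) (4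
      * (C2cov (P r K s).d * Real.exp (2 * δ' * r₀e)) * (ε₄e + B₀e * be) ^ 2) (solAt (𝒢e r K t s V) 0 (W𝒱e r K t s V) ε₄e (0 : 𝒵e r K s) (H₁e r K t s
      V (Te r K t s V (cplx x))) + H₁e r K t s V (Te r K t s V (cplx x)))))).re + (-Real.log (∫ ω, g r K t s ω * Real.exp (Aex r K t s V x ω) ∂(μ r K
      t s))))))))
    (hudict : ∀ r K t s, ∀ V, ∀ x ∈ cube (m₀ r K s) S, u r K t s (fixTo (combBonds (lo r K s) (hi r K s)) 1 (updateFinset V (Λ r K s) (expFibreChart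
      (Λ r K s) 1 (e r K s) x))) = classifier (hPu r K t s) (fun p => holOf (plaqReadOuts (Λu r K t s) (η r (jl r K s)) (U₀u r K t s) (wu r K t s)
      (wu' r K t s) (plq r K t s p).1 (plq r K t s p).2.1 (plq r K t s p).2.2) (fun y => landauExp ((ball (0 : ↥(Sf r K s) → 𝔸 r K s) (landauRad (P r
      K s).d (P r K s).L)).indicator (landauCf (P r K s).L (1 : B7Prop1Explicit.Site (P r K s).d → Fin (P r K s).d → (𝔸 r K s)ˣ) (k r K s) (Sf r K s)
      (Sf' r K s))) (ιs r K t s V) (Hop r K t s V) (4 * C2cov (P r K s).d * (ε₄ + B₀ * (2 * dL * C₁ * ε₁)) ^ 2) (solAt (𝒢 r K t s V) 0 (W𝒱 r K t s V)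
      ε₄ (0 : 𝒵 r K s) (H₁ r K t s V (TΦ r K t s V (cplx y))) + H₁ r K t s V (TΦ r K t s V (cplx y))))) x)
    (hδ0 : 0 ≤ δ) (hδ1 : δ < 1) {c₁ c₂ zs : ℝ}
    (hη1 : ∀ r K s, η r (jl r K s) ≤ 1)
    (hs₁' : ∀ r K s, 2 * ((ε₄ + B₀ * (2 * dL * C₁ * ε₁)) + B₀ * (4 * C2cov (P r K s).d * (ε₄ + B₀ * (2 * dL * C₁ * ε₁)) ^ 2)) ≤ c₁ * w₀' ^ 2 * zs)
    (ha' : ∀ r K s, ((ε₄ + B₀ * (2 * dL * C₁ * ε₁)) + B₀ * (4 * C2cov (P r K s).d * (ε₄ + B₀ * (2 * dL * C₁ * ε₁)) ^ 2)) ≤ c₂ * w₀ * zs)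
    (hma' : ∀ r K s, 4 * ((ε₄ + B₀ * (2 * dL * C₁ * ε₁)) + B₀ * (4 * C2cov (P r K s).d * (ε₄ + B₀ * (2 * dL * C₁ * ε₁)) ^ 2)) ≤ w₀)
    (hsm : ∀ r K s, 36 * (c₁ * zs + (4 : ℕ) ^ 2 * c₂ ^ 2 * zs ^ 2) / (rΦ / S - 1) ^ 2 ≤ δ * ε r (K - lvl r K s)) {a : ℝ} (ha0 : 0 ≤ a)
    (hrad : ∀ r K s, (((P r K s).d - 1 : ℕ) : ℝ) * nb r K s * a ≤ 2 * Real.sin (S / 2))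
    {Pcore Pcollar : ∀ r K (t : ℝ) s, Set (Plaq (P r K s) (jl r K s))}
    (hcover : ∀ r K t s, boxPlaqs (lo r K s) (hi r K s) ⊆ Pcore r K t s ∪ (Pcollar r K t s))
    (hcore : ∀ r K t s, ∀ (V : GaugeField (P r K s) (jl r K s) SU2) (y : ↥(Λ r K s) → SU2), u r K t s (fixTo (combBonds (lo r K s) (hi r K s)) 1
      (updateFinset V (Λ r K s) y)) < ε r (K - lvl r K s) * η r (jl r K s) ^ 2 → PlaqSmallOn (Pcore r K t s) a (fixTo (combBonds (lo r K s) (hi r K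
      s)) 1 (updateFinset V (Λ r K s) y)))
    (hcollar : ∀ r K t s, ∀ (V : GaugeField (P r K s) (jl r K s) SU2) (y : ↥(Λ r K s) → SU2), F r K t s (fixTo (combBonds (lo r K s) (hi r K s)) 1
      (updateFinset V (Λ r K s) y)) ≠ 0 → PlaqSmallOn (Pcollar r K t s) a (fixTo (combBonds (lo r K s) (hi r K s)) 1 (updateFinset V (Λ r K s) y)))
    (hρ : ∀ r j, ρ r j ≤ (1 - δ) / 2) (hβ : ∀ r j, 0 ≤ β r j)
    -- the slot → level majorant: the host's (= S99 f3b's) slot constant (written out ONCE) under the displayed level profile `D r`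
    (hDslot : ∀ r K t, |t| ≤ l₀ → ∀ s ∈ Sl r K, 2 * ((m₀ r K s : ℝ) + (3 * (|β r (jl r K s)| * ((dbar r (jl r K s) + 2 * (κcb r (jl r K s) * (cH₁ *
      MH₁ * bw / ((1 - c𝒢 * M𝒢 * (2 * C₄w * a₃w * Real.exp (δw * rW))) * (1 - 2 * C2cov (P r K s).d * landauRad (P r K s).d (P r K s).L * Real.exp (δw
      * rC) * (cι * Mι) * (cH * MH)))) + expTail₂ (mw * (κwb r (jl r K s) * (cH₁ * MH₁ * bw / ((1 - c𝒢 * M𝒢 * (2 * C₄w * a₃w * Real.exp (δw * rW))) *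
      (1 - 2 * C2cov (P r K s).d * landauRad (P r K s).d (P r K s).L * Real.exp (δw * rC) * (cι * Mι) * (cH * MH))))))) / (rΦw / S)) * (2 * (κcb r (jl
      r K s) * (cH₁ * MH₁ * bw / ((1 - c𝒢 * M𝒢 * (2 * C₄w * a₃w * Real.exp (δw * rW))) * (1 - 2 * C2cov (P r K s).d * landauRad (P r K s).d (P r K
      s).L * Real.exp (δw * rC) * (cι * Mι) * (cH * MH)))) + expTail₂ (mw * (κwb r (jl r K s) * (cH₁ * MH₁ * bw / ((1 - c𝒢 * M𝒢 * (2 * C₄w * a₃w *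
      Real.exp (δw * rW))) * (1 - 2 * C2cov (P r K s).d * landauRad (P r K s).d (P r K s).L * Real.exp (δw * rC) * (cι * Mι) * (cH * MH))))))) / (rΦw
      / S))) * Kw r (jl r K s)) + (3 * (LK * (2 * ((ε₄e + B₀e * be) + B₀e * (4 * (C2cov (P r K s).d * Real.exp (2 * δ' * r₀e)) * (ε₄e + B₀e * be) ^
      2)))) / (rΦe / S - 1) + Bd))) / (1 - δ) ≤ D r (lvl r K s))
    -- END-I's own rows ((R)+[dict] with the NORMALISED variables, finiteness, windows, `D ≤ D̄`, rates) — S27 VERBATIM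
    {ι : Type*} {T : ℕ → Finset ι} {A B shA shB : ℕ → ℝ → ι → ℝ}
    {pieceA pieceB : ℕ → ℝ → σ → ι → ℝ} {MA MB : ℕ → ℝ → σ → ℝ} {N₁ : ℕ} {νbar Dbar crate ϑ : ℝ}
    (hFfin : ∀ r K t s, ∫⁻ U, F r K t s U ∂(fieldMeasure (P r K s) (jl r K s) SU2) ≠ ∞)
    (sh_nonnegA : ∀ K t, |t| ≤ l₀ → ∀ τ ∈ T K, 0 ≤ shA K t τ)
    (sh_leA : ∀ K t, |t| ≤ l₀ → ∀ τ ∈ T K, shA K t τ ≤ A K t τ)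
    (coverA : ∀ K t, |t| ≤ l₀ → ∀ τ ∈ T K, shA K t τ ≤ ∑ s ∈ Sl true K, pieceA K t s τ)
    (hMA : ∀ K t, |t| ≤ l₀ → ∀ s ∈ Sl true K, 0 ≤ MA K t s)
    (piece_leA : ∀ K t, |t| ≤ l₀ → ∀ s ∈ Sl true K, ∑ τ ∈ T K, pieceA K t s τ ≤ MA K t s *
      (((fieldMeasure (P true K s) (jl true K s) SU2).withDensity (F true K t s))
        {x | ε true (K - lvl true K s) * (1 - ρ true (lvl true K s)) ≤ u true K t s x / η true (jl true K s) ^ 2 ∧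
          u true K t s x / η true (jl true K s) ^ 2 < ε true (K - lvl true K s)}).toReal)
    (total_geA : ∀ K t, |t| ≤ l₀ → ∀ s ∈ Sl true K,
      MA K t s * (((fieldMeasure (P true K s) (jl true K s) SU2).withDensity (F true K t s)) Set.univ).toReal ≤
        ∑ τ ∈ T K, A K t τ)
    (sh_nonnegB : ∀ K t, |t| ≤ l₀ → ∀ τ ∈ T K, 0 ≤ shB K t τ)
    (sh_leB : ∀ K t, |t| ≤ l₀ → ∀ τ ∈ T K, shB K t τ ≤ B K t τ)
    (coverB : ∀ K t, |t| ≤ l₀ → ∀ τ ∈ T K, shB K t τ ≤ ∑ s ∈ Sl false K, pieceB K t s τ)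
    (hMB : ∀ K t, |t| ≤ l₀ → ∀ s ∈ Sl false K, 0 ≤ MB K t s)
    (piece_leB : ∀ K t, |t| ≤ l₀ → ∀ s ∈ Sl false K, ∑ τ ∈ T K, pieceB K t s τ ≤ MB K t s *
      (((fieldMeasure (P false K s) (jl false K s) SU2).withDensity (F false K t s))
        {x | ε false (K - lvl false K s) * (1 - ρ false (lvl false K s)) ≤ u false K t s x / η false (jl false K s) ^ 2 ∧
          u false K t s x / η false (jl false K s) ^ 2 < ε false (K - lvl false K s)}).toReal)
    (total_geB : ∀ K t, |t| ≤ l₀ → ∀ s ∈ Sl false K,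
      MB K t s * (((fieldMeasure (P false K s) (jl false K s) SU2).withDensity (F false K t s)) Set.univ).toReal ≤
        ∑ τ ∈ T K, B K t τ)
    (hw : ∀ r, LiveWindow (Sl r) (lvl r) N₁ νbar) (hϑ0 : 0 < ϑ) (hϑ1 : ϑ < 1)
    (hDbar : ∀ r j, D r j ≤ Dbar) (hrate : ∀ r j, ρ r j ≤ crate * ϑ ^ j) :
    ShellWeightBound l₀ T A B shA shB
      (fun K => ∑ s ∈ Sl true K, D true (lvl true K s) * ρ true (lvl true K s) +
        ∑ s ∈ Sl false K, D false (lvl false K s) * ρ false (lvl false K s)) := by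
  -- file 1: END-II (the junction chain's end host) ∘ γ8 unit change, over the indexed families (both runs, every slot)
  have hlive := hac_live_of_assembled_decay_levels_cfB7_lin_junction P jl lvl hη hε hρ0 hn hN Λ hΛbox hΛcomb e hS hSπ hF hFi hu hui hPu plq N hPuN holN hRN hθN hδ0N hδ1N hSMN
    hANN Λu U₀u hU₀u wu wu' hw₀ hw₀' hfl hfl' 𝒢 W𝒱 h𝒢 hW hB₀ hC₄ hε₄ hdL hC₁ hε₁ hB₃ h1 h2 h3 H₁ hH₁ TΦ hTb hSr k Sf Sf' Sw Sw' Se Se' Ubg hUbg hα hα3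
    hα4 hα6 h52locw h52loce ϖe₁ ϖe₂ hϖe₁ hϖe₂ hreache ιs hι Hop hH h18 hcoup h3R hδw Bref hBref pos posz pos' posx posb hmultw hmultz hmultx hmultb k𝒢
    kι kH kH₁ hc𝒢 hk𝒢 hgap𝒢 hM𝒢c hcι hkι hgapι hMιc hcH hkH hgapH hMHc hcH₁ hkH₁ hgapH₁ hMH₁c W𝒱w hB𝒢w hWw hB₀w hC₄w hε₄w hdomw hselfw hcontrw hBH₁w
    Tw hTbw h2Sw hιw hBHw hqw hRCw NW hlocW hreachW hreachC hsupp hqW hk Pw ℓw suppw ϖPw hblindw hdepthw hϖPw hκwb hκcb hℓwb hcurlw hlenw 𝓡𝒴w h𝓡𝒴w 𝓡𝒵w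
    𝓡ℬw h𝒢rw hWrw hιrw hHrw hH₁rw hTrw hskew Bp hBu hBd hd hdbar hKw hδ' hϖ 𝒢e W𝒱e h𝒢e hWe hB₀e hC₄e hbe hε₄e hdome hselfe hcontre H₁e hH₁e Te hTbe
    hSre ιe hιe He hHe hqe hRCe I hrE hEd hEb supp hblind ϖP hdepth hK hcoupE μ hg Aex hint hpos hA hElb₂ L 𝓡𝒵 𝓡ℬ h𝒢r hWr hιr hHr hH₁r hTr hRdict
    hudict hδ0 hδ1 hη1 hs₁' ha' hma' hsm ha0 hrad hcover hcore hcollar hρ hβ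
  -- END-I (S27 §2: slot towers, age thresholds) with `hacA`∕`hacB` DISCHARGED by `hlive true` ∕ `hlive false`
  exact shellWeightBound_of_towerData_sync (G := SU2) (PA := P true) (jA := jl true) (PB := P false) (jB := jl false)
    (θA := fun K s => ε true (K - lvl true K s)) (θB := fun K s => ε false (K - lvl false K s))
    (uA := fun K t s U => u true K t s U / η true (jl true K s) ^ 2)
    (uB := fun K t s U => u false K t s U / η false (jl false K s) ^ 2)
    (hFfin true) sh_nonnegA sh_leA coverA hMA piece_leA total_geA (hD0 true) (hρ0 true) (hDslot true)
    (fun K t _ s _ => hlive true K t s)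
    (hFfin false) sh_nonnegB sh_leB coverB hMB piece_leB total_geB (hD0 false) (hρ0 false) (hDslot false)
    (fun K t _ s _ => hlive false K t s)
    (hw true) (hw false) hϑ0 hϑ1 (hDbar true) (hDbar false) (hrate true) (hrate false)

/-- **(x2⁶) NON-DEGENERACY ACROSS LEVELS** (rule G-1′; R-ne7cp1-g34-1 ∕ R-ne7cp1-g35-4 (c) ∕ R-ne7cp1-g36-13 (x3⁶)): after link (4) of
the junction wave the classifier read-out constants are DERIVED — `κr = η∕w₀`, `κc = 2η²∕w₀′²`, `m = 4` (S109) — and the (SM) rows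
are the level-FREE numbers `hs₁′ ha′ hma′` plus `hη1 : η ≤ 1`.  With the designed profile `η r j := (2^j)⁻¹` — `η r 0 = 1 ≠ 1∕2 =
η r 1`, TWO levels of DIFFERENT fine scale — every level has `0 < η r j ≤ 1` and a NONZERO read-out constant `η r j ∕ w₀`
(`w₀ = 1`), and the three level-free rows hold with a NONZERO amplitude `X = 1∕4` at `w₀ = w₀′ = c₁ = c₂ = zs = 1`:
`2X ≤ c₁·w₀′²·zs`, `X ≤ c₂·w₀·zs`, `4X ≤ w₀` — the same numbers at EVERY level (nothing level-blind is forced to vanish, cf.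
F-ne7cL05g9-1 on S92). [folklore] -/
example : ((fun (_ : Bool) (j : ℕ) => ((2 : ℝ) ^ j)⁻¹) true 0 ≠ (fun (_ : Bool) (j : ℕ) => ((2 : ℝ) ^ j)⁻¹) true 1) ∧
    (∀ (r : Bool) (j : ℕ), 0 < (fun (_ : Bool) (j : ℕ) => ((2 : ℝ) ^ j)⁻¹) r j ∧ (fun (_ : Bool) (j : ℕ) => ((2 : ℝ) ^ j)⁻¹) r j ≤ 1 ∧
      (fun (_ : Bool) (j : ℕ) => ((2 : ℝ) ^ j)⁻¹) r j / (1 : ℝ) ≠ 0) ∧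
    (2 * (1 / 4 : ℝ) ≤ 1 * 1 ^ 2 * 1 ∧ (1 / 4 : ℝ) ≤ 1 * 1 * 1 ∧ 4 * (1 / 4 : ℝ) ≤ 1) := by
  refine ⟨by norm_num, fun r j => ⟨by positivity, ?_, ?_⟩, by norm_num⟩
  · simpa using inv_le_one_of_one_le₀ (one_le_pow₀ (by norm_num : (1 : ℝ) ≤ 2))
  · rw [div_one]; positivity

end Summit.QuantumFields.BalabanUV.T4Continuum.ShellMeasureLiveEndOneCallLevelsCfLinJunction

end
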